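import Literature.Computability.Complexity.EasyWitnessGenerator
import Literature.Computability.Complexity.PRGDerandomization
import Literature.Computability.Complexity.IsqrtBrick
import Literature.Computability.Complexity.MerlinArthurTests
import Literature.Computability.Complexity.IKWScales
import HarnessLib

/-!
# The nondeterministic simulation of `MA` armed with generated truth tables: the machine
# (IKW 2002, Thm. 12, after Goldreich–Zuckerman)

Literature / circuit complexity — derandomization. The MACHINE half of the proof of
Impagliazzo–Kabanets–Wigderson's Theorem 12 (`IKWGenerators.lean`, named facts `IKW2002_thm12_1/2`:
a `poly(2ⁿ)`-time nondeterministic generator of hard truth tables with advice `a(n)` —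
`TruthTableGenerator a` — gives `MA ⊆ (io-)[NTIME(2^{N^ε})/a(N^ε)]`), whose printed proof is
"Theorem 11 readily implies the following" after the remark that "[GZ97] show that a quick
`SIZE(n)`-pseudorandom generator … allows one to decide every `MA` language in nondeterministic
time `2^{n^k}` … for the case of `MA`, a nondeterministic algorithm [generating the hard functions]
suffices". Spelled out: on input `x` (with the generator's advice `α` glued to it) the simulating
machine guesses Merlin's message `y` AND an accepting computation `g` of the generator, obtains a
truth table `t`, and replaces Arthur's coins by the outputs of the generator `G_t(s) = F(t, s)` of
Theorem 11 on ALL seeds `s`, accepting iff a majority of them make Arthur's predicate accept.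

This file builds that machine over the tree's `TM2`/`FP` toolkit and proves its running time; the
correctness (pseudorandomness of `G_t` for hard `t`, the `2/3`–`1/3` gap) and the class-level
conclusion are in `IKWGeneratorsProofs.lean`. For a generator `G : TruthTableGenerator a`, a referee
`Ref ∈ P` with move length `mv`, a string function `F ∈ FP` with seed constant `c` (seeds of length
`c·m^{sx}` at table scale `m` — a polynomial seed, `sx ≥ 1`; the discrete Theorem 11 recorded in
`HardnessVsRandomness.lean` has `sx = 2`, the construction reachable with the tree's algebraic designs
has `sx = 4`), an output-length polynomial `Nb` and a root depth `j`:

* the TABLE SCALE of an input length `N` is `m(N) = Nat.sqrt^[j] N` (`IKWScales.lean`), laid out in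
  unary by `scaleF j` (iterated `isqrtFn`, `IsqrtBrick.lean`); `kF` (`1^{c m^{sx}}`, the seed length),
  `eF` (`1^{(c + c_G) m^{sx}}`, the exponent of the padding), `bgF` (`1^{c_G 2^{c_G m} + c_G}`, the
  admissible guess length of `G`, measured on a ruler);
* **Stage 1, the clock** (`exists_clock_machine`, `exists_trunc_machine`): `w ↦ ⟨⟨w, P⟩, 1^U⟩` with the
  pad `P = 1^{2^e + 1}` (the tree's exponential clock `expClock 1 1` under `mapFstAux`,
  `NTIMEPadding.lean` / `MapFstMachine.lean`) and the kept witness length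
  `U = 2·mv(N) + 2 + (c_G 2^{c_G m} + c_G)`, feeding the truncating wrapper `truncMapAux`
  (`TruncMapMachine.lean`), which hands `⟨⟨w, P⟩, u ↾ U⟩` to the body having read the rest of the
  witness `u` two symbols per step (the one-constant time bound of `NTIME`);
* **Stage 2, the preparation** (`preF`, `preF_apply`): split the kept witness `u' = ⟨y', g'⟩`, normalise
  `y = takeD mv(N) y'`, cut `g = g' ↾ (c_G 2^{c_G m} + c_G)` (so that the generator's specification
  applies to EVERY guess), and lay out `⟨⟨⟨1^m, α⟩, g⟩, ⟨⟨w, P⟩, y⟩⟩`, `α = snd w`;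
* **Stage 3**: the generator's own machine under `mapFstAux`: the first component becomes the code
  `encodeTableOpt (G.gen m α g)` (`[0]` = reject, `1 t` = accept with table `t`);
* **Stage 4, the verdict** (`postF`, `postF_apply`; the counted-fold idiom of
  `PRGDerandomization.lean`, Arora–Barak's proof of Lemma 20.3): reject if the generator rejected;
  otherwise the fold over `i < 2^{c m^{sx}}` (capacity `|P| ≥ 2^{c m^{sx}}`) of the bits
  `[⟨x, enc (y, (F⟨t, ⟨1^{Nb(N)}, ρᵢ⟩⟩) ↾ mv(N))⟩ ∈ Ref]`, `ρᵢ = takeD (c m^{sx}) (bin i)`, and the comparison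
  `[2^{c m^{sx}} < 2 · count]`;
* `verdictBit` — the input/output behaviour of the whole verifier as a Boolean function of `(w, u)`,
  and **`exists_verifier`**: a `TM2` machine computing `[verdictBit w u]` on EVERY pair `⟨w, u⟩` within
  `c₂ (2^{(c+c_G) m^{sx}} + |w|)^{c₂} + c₂ + |u|/2` steps, `m = m(|fst w|)`;
* `simLang` — the language of words having an admissible witness accepted by the verifier, and
  **`exists_simLang_mem_NTIME`**: `simLang ∈ NTIME(2^{⌈M^ε⌉₊})` once `sx·2^{-j} < ε` (the cost bound
  `eventually_cost_pow_le_two_pow_ceil_rpow` of `IKWScales.lean`, one constant for all lengths).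

Everything is proved. Mathlib has no complexity classes; nothing duplicates the tree (searched
`verdictBit`, `scaleF`, `simulation of MA`, `Goldreich–Zuckerman`: the deterministic analogue is
`PRGDerand.verdictF`, whose bricks are reused, not copied).

## References

* R. Impagliazzo, V. Kabanets, A. Wigderson, *In search of an easy witness: exponential time vs.
  probabilistic polynomial time*, JCSS 65 (2002) 672–694, §2.4, Thm. 12 and the paragraph before it
  [ImpagliazzoKabanetsWigderson2002] (held text `paper:doi-10-1016-s0022-0000-02-00024-7`, p. 8).
* O. Goldreich, D. Zuckerman, *Another proof that BPP ⊆ PH (and more)*, ECCC TR97-045 (1997)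
  (the nondeterministic simulation of `MA`; cited through IKW §2.4).
* S. Arora, B. Barak, *Computational Complexity: A Modern Approach*, CUP 2009, proof of Lemma 20.3
  (enumerate all seeds, majority vote), proof of Lemma 20.20 (p. 417: "Arthur … use[s] `y` as a
  function for a pseudorandom generator to verify Merlin's proof"), §1.3 [AroraBarakCC2009].
-/

noncomputable section

namespace Literature.Computability.Complexity

open _root_.Computability Turing Finset Filter Polynomial Brick Plumb

namespace IKWSim

/-! ### The table scale in unary -/

/-- One integer square root in unary: `w ↦ 1^{⌊√|w|⌋}` (`isqrtFn` gives the numeral, `binToUnaryFn`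
measures it on the ruler `w`). [folklore] -/
def sqrtUF : List Bool → List Bool := binToUnaryFn ∘ fanoutFn (fun w => w) isqrtFn

/-- Value of `sqrtUF`. [folklore] -/
@[simp] theorem sqrtUF_apply (w : List Bool) : sqrtUF w = ones (Nat.sqrt w.length) := by
  simp only [sqrtUF, Function.comp_apply, fanoutFn_apply, isqrtFn_apply, binToUnaryFn_boolPair,
    bitsToNat_encodeNat, min_eq_left (Nat.sqrt_le_self _)]

/-- `sqrtUF ∈ FP`. [folklore] -/
theorem sqrtUF_mem_FP : sqrtUF ∈ FP :=
  comp_mem_FP binToUnaryFn_mem_FP (fanoutFn_mem_FP (PolyTimeComputable.id _) isqrtFn_mem_FP)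

/-- **The table scale in unary**: `scaleF j w = 1^{m(|w|)}`, `m = Nat.sqrt^[j]` (`IKWScales.lean`).
[cite: ImpagliazzoKabanetsWigderson2002, Thm. 12 (proof)] -/
def scaleF (j : ℕ) : List Bool → List Bool := sqrtUF^[j] ∘ onesFn

/-- Value of `scaleF`. [folklore] -/
@[simp] theorem scaleF_apply (j : ℕ) (w : List Bool) : scaleF j w = ones (Nat.sqrt^[j] w.length) := by
  induction j generalizing w with
  | zero => simp [scaleF, ones, onesFn, OracleCompose.unaryEncodeNat_eq_replicate]
  | succ j ih =>
    have h : scaleF (j + 1) w = sqrtUF (scaleF j w) := by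
      simp only [scaleF, Function.comp_apply, Function.iterate_succ_apply']
    rw [h, ih, sqrtUF_apply, Function.iterate_succ_apply']
    simp [ones]

/-- `scaleF j ∈ FP`. [folklore] -/
theorem scaleF_mem_FP (j : ℕ) : scaleF j ∈ FP := by
  induction j with
  | zero => exact comp_mem_FP (PolyTimeComputable.id _) onesFn_mem_FP
  | succ j ih =>
    have : scaleF (j + 1) = sqrtUF ∘ scaleF j := by
      funext w; simp only [scaleF, Function.comp_apply, Function.iterate_succ_apply']
    rw [this]; exact comp_mem_FP sqrtUF_mem_FP ih

/-! ### Parameters laid out in unary -/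

section Params

variable (c cG sx j : ℕ)

/-- The seed length `1^{c m^{sx}}` from `x`. [folklore] -/
def kF : List Bool → List Bool := onesMulFn c ∘ polyFn (X ^ sx) ∘ scaleF j

/-- The padding exponent `1^{(c + c_G) m^{sx}}` from `x`. [folklore] -/
def eF : List Bool → List Bool := onesMulFn (c + cG) ∘ polyFn (X ^ sx) ∘ scaleF j

/-- The numeral of `2^{c_G m}` from `x`: `0^{c_G m} 1`. [folklore] -/
def gExpNumF : List Bool → List Bool := (fun w => Kannan.zerosFn w ++ [true]) ∘ onesMulFn cG ∘ scaleF j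

/-- **The admissible guess length** `1^{c_G 2^{c_G m} + c_G}` from `⟨P, x⟩`, the power of two measured
on the ruler `P` (correct once `2^{c_G m} ≤ |P|`). [folklore] -/
def bgF : List Bool → List Bool :=
  (fun w => onesMulFn cG w ++ ones cG) ∘ binToUnaryFn ∘ fanoutFn fstF (gExpNumF cG j ∘ sndF)

/-- Value of `kF`. [folklore] -/
@[simp] theorem kF_apply (x : List Bool) : kF c sx j x = ones (c * (Nat.sqrt^[j] x.length) ^ sx) := by
  simp [kF, onesMulFn, ones]

/-- Value of `eF`. [folklore] -/
@[simp] theorem eF_apply (x : List Bool) : eF c cG sx j x = ones ((c + cG) * (Nat.sqrt^[j] x.length) ^ sx) := by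
  simp [eF, onesMulFn, ones]

/-- Value of `gExpNumF`. [folklore] -/
@[simp] theorem gExpNumF_apply (x : List Bool) :
    gExpNumF cG j x = encodeNat (2 ^ (cG * Nat.sqrt^[j] x.length)) := by
  simp [gExpNumF, onesMulFn, ones, Com.encodeNat_two_pow]

/-- Value of `bgF` on a long enough ruler. [folklore] -/
theorem bgF_apply (P x : List Bool) (hP : 2 ^ (cG * Nat.sqrt^[j] x.length) ≤ P.length) :
    bgF cG j (boolPair P x) = ones (cG * 2 ^ (cG * Nat.sqrt^[j] x.length) + cG) := by
  rw [bgF, Function.comp_apply, Function.comp_apply, fanoutFn_apply, fstF_boolPair, Function.comp_apply,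
    sndF_boolPair, gExpNumF_apply, binToUnaryFn_boolPair, bitsToNat_encodeNat, min_eq_left hP]
  simp only [onesMulFn, ones, List.length_replicate]
  rw [← List.replicate_add]

/-- The guess length never exceeds `c_G |P| + c_G` (whatever the ruler). [folklore] -/
theorem length_bgF_le (w : List Bool) : (bgF cG j w).length ≤ cG * (fstF w).length + cG := by
  simp only [bgF, Function.comp_apply, fanoutFn_apply, List.length_append, onesMulFn,
    List.length_replicate, ones]
  have := length_binToUnaryFn_boolPair_le (fstF w) (gExpNumF cG j (sndF w))
  nlinarith

/-- `kF ∈ FP`. [folklore] -/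
theorem kF_mem_FP : kF c sx j ∈ FP :=
  comp_mem_FP (onesMulFn_mem_FP c) (comp_mem_FP (polyFn_mem_FP _) (scaleF_mem_FP j))

/-- `eF ∈ FP`. [folklore] -/
theorem eF_mem_FP : eF c cG sx j ∈ FP :=
  comp_mem_FP (onesMulFn_mem_FP _) (comp_mem_FP (polyFn_mem_FP _) (scaleF_mem_FP j))

/-- `gExpNumF ∈ FP`. [folklore] -/
theorem gExpNumF_mem_FP : gExpNumF cG j ∈ FP :=
  comp_mem_FP (append_mem_FP Kannan.zerosFn_mem_FP (const_mem_FP [true]))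
    (comp_mem_FP (onesMulFn_mem_FP cG) (scaleF_mem_FP j))

/-- `bgF ∈ FP`. [folklore] -/
theorem bgF_mem_FP : bgF cG j ∈ FP :=
  comp_mem_FP (append_mem_FP (onesMulFn_mem_FP cG) (const_mem_FP _))
    (comp_mem_FP binToUnaryFn_mem_FP (fanoutFn_mem_FP fstF_mem_FP (comp_mem_FP (gExpNumF_mem_FP cG j) sndF_mem_FP)))

end Params

/-! ### Stage 4: the verdict (majority vote over all seeds) -/

section Post

variable (Ref : Language Bool) (F : List Bool → List Bool) (mv Nb : Polynomial ℕ) (c sx j : ℕ)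

/-! The verdict works on the fold record `X = ⟨P, ⟨⟨x, y⟩, t⟩⟩` (ruler, input, Merlin's message, table);
the pieces of the fold receive `Z = ⟨X, 1ⁱ⟩`. -/

/-- Field `x` of a piece argument `⟨⟨P, ⟨⟨x, y⟩, t⟩⟩, 1ⁱ⟩`. [folklore] -/
def xZ : List Bool → List Bool := fstF ∘ fstF ∘ sndF ∘ fstF
/-- Field `y` of a piece argument. [folklore] -/
def yZ : List Bool → List Bool := sndF ∘ fstF ∘ sndF ∘ fstF
/-- Field `t` of a piece argument. [folklore] -/
def tZ : List Bool → List Bool := sndF ∘ sndF ∘ fstF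
/-- The round index `1ⁱ` of a piece argument. [folklore] -/
def iZ : List Bool → List Bool := sndF

/-- The `i`-th seed `ρᵢ = takeD (c m^{sx}) (bin i)`. [cite: AroraBarakCC2009, Lemma 20.3 (proof)] -/
def seedZ : List Bool → List Bool := fstF ∘ padTakeFn ∘ fanoutFn (kF c sx j ∘ xZ) (lenBinF ∘ iZ)

/-- The generator's output on the `i`-th seed: `F ⟨t, ⟨1^{Nb(N)}, ρᵢ⟩⟩`. [cite: ImpagliazzoKabanetsWigderson2002, Thm. 11] -/
def outZ : List Bool → List Bool := F ∘ fanoutFn tZ (fanoutFn (polyFn Nb ∘ xZ) (seedZ c sx j))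

/-- Arthur's coins in round `i`: the first `mv(N)` output bits, padded. [folklore] -/
def coinsZ : List Bool → List Bool := fstF ∘ padTakeFn ∘ fanoutFn (polyFn mv ∘ xZ) (outZ F Nb c sx j)

/-- **The piece of round `i`**: the bit `[⟨x, enc (y, coinsᵢ)⟩ ∈ Ref]` as a one-symbol string.
[cite: ImpagliazzoKabanetsWigderson2002, Thm. 12 (proof)] -/
def pieceZ : List Bool → List Bool :=
  (fun w => encodeBool ((AMTwo.toRefFn ⁻¹' Ref : Language Bool).boolIndicator w)) ∘
    fanoutFn (fanoutFn xZ yZ) (coinsZ F mv Nb c sx j)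

/-- Field `x` of the record `X = ⟨P, ⟨⟨x, y⟩, t⟩⟩`. [folklore] -/
def xX : List Bool → List Bool := fstF ∘ fstF ∘ sndF

/-- The number of seeds as a numeral: `X ↦ bin 2^{c m^{sx}} = 0^{c m^{sx}} 1`. [folklore] -/
def cntNumX : List Bool → List Bool := (fun w => Kannan.zerosFn w ++ [true]) ∘ kF c sx j ∘ xX

/-- The fold's initial record `X ↦ ⟨X, ⟨bin 2^{c m^{sx}}, ⟨1⁰, bin 0⟩⟩⟩`. [folklore] -/
def initX : List Bool → List Bool := fanoutFn (fun w => w) (fanoutFn (cntNumX c sx j) fun _ => boolPair [] [])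

/-- **The number of accepting seeds**, as a numeral: the counted fold over `i < 2^{c m^{sx}}` with
capacity `|X|` rounds. [cite: AroraBarakCC2009, Lemma 20.3 (proof)] -/
def accX : List Bool → List Bool :=
  sndPow 2 ∘ foldLoop addFn (clipF 1 (pieceZ Ref F mv Nb c sx j)) X ∘ initX c sx j

/-- **The verdict on a record**: `[2^{c m^{sx}} < 2 · #accepting seeds]`. [cite: AroraBarakCC2009, Lemma 20.3 (proof)] -/
def verdictX : List Bool → List Bool :=
  ltFn ∘ fanoutFn (cntNumX c sx j) (addFn ∘ fanoutFn (accX Ref F mv Nb c sx j) (accX Ref F mv Nb c sx j))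

/-- The record `X = ⟨P, ⟨⟨x, y⟩, t⟩⟩` made from the stage-4 input `⟨code, ⟨⟨w, P⟩, y⟩⟩`
(`x = fst w`, `t = tail code`). [folklore] -/
def mkX : List Bool → List Bool :=
  fanoutFn (sndF ∘ fstF ∘ sndF)
    (fanoutFn (fanoutFn (fstF ∘ fstF ∘ fstF ∘ sndF) (sndF ∘ sndF)) (List.tail ∘ fstF))

/-- **Stage 4**: reject if the generator rejected (code `0…`), else the verdict on the record.
[cite: ImpagliazzoKabanetsWigderson2002, Thm. 12 (proof)] -/
def postF : List Bool → List Bool :=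
  iteFn (take1Fn ∘ fstF) (verdictX Ref F mv Nb c sx j ∘ mkX) fun _ => [false]

/-! #### Membership in `FP` -/

variable {Ref F}

/-- `xZ ∈ FP`. [folklore] -/
theorem xZ_mem_FP : xZ ∈ FP :=
  comp_mem_FP fstF_mem_FP (comp_mem_FP fstF_mem_FP (comp_mem_FP sndF_mem_FP fstF_mem_FP))
/-- `yZ ∈ FP`. [folklore] -/
theorem yZ_mem_FP : yZ ∈ FP :=
  comp_mem_FP sndF_mem_FP (comp_mem_FP fstF_mem_FP (comp_mem_FP sndF_mem_FP fstF_mem_FP))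
/-- `tZ ∈ FP`. [folklore] -/
theorem tZ_mem_FP : tZ ∈ FP := comp_mem_FP sndF_mem_FP (comp_mem_FP sndF_mem_FP fstF_mem_FP)
/-- `iZ ∈ FP`. [folklore] -/
theorem iZ_mem_FP : iZ ∈ FP := sndF_mem_FP
/-- `xX ∈ FP`. [folklore] -/
theorem xX_mem_FP : xX ∈ FP := comp_mem_FP fstF_mem_FP (comp_mem_FP fstF_mem_FP sndF_mem_FP)

/-- `seedZ ∈ FP`. [folklore] -/
theorem seedZ_mem_FP : seedZ c sx j ∈ FP :=
  comp_mem_FP fstF_mem_FP (comp_mem_FP padTakeFn_mem_FP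
    (fanoutFn_mem_FP (comp_mem_FP (kF_mem_FP c sx j) xZ_mem_FP) (comp_mem_FP lenBinF_mem_FP iZ_mem_FP)))

/-- `outZ ∈ FP` for `F ∈ FP`. [folklore] -/
theorem outZ_mem_FP (hF : F ∈ FP) : outZ F Nb c sx j ∈ FP :=
  comp_mem_FP hF (fanoutFn_mem_FP tZ_mem_FP
    (fanoutFn_mem_FP (comp_mem_FP (polyFn_mem_FP Nb) xZ_mem_FP) (seedZ_mem_FP c sx j)))

/-- `coinsZ ∈ FP` for `F ∈ FP`. [folklore] -/
theorem coinsZ_mem_FP (hF : F ∈ FP) : coinsZ F mv Nb c sx j ∈ FP :=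
  comp_mem_FP fstF_mem_FP (comp_mem_FP padTakeFn_mem_FP
    (fanoutFn_mem_FP (comp_mem_FP (polyFn_mem_FP mv) xZ_mem_FP) (outZ_mem_FP Nb c sx j hF)))

/-- `pieceZ ∈ FP` for `Ref ∈ P`, `F ∈ FP`. [cite: AroraBarakCC2009, §1.3 (composition)] -/
theorem pieceZ_mem_FP (hRef : Ref ∈ Classes.P) (hF : F ∈ FP) : pieceZ Ref F mv Nb c sx j ∈ FP :=
  comp_mem_FP (indicatorFn_mem_FP (preimage_mem_P hRef AMTwo.toRefFn_mem_FP))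
    (fanoutFn_mem_FP (fanoutFn_mem_FP xZ_mem_FP yZ_mem_FP) (coinsZ_mem_FP mv Nb c sx j hF))

/-- `cntNumX ∈ FP`. [folklore] -/
theorem cntNumX_mem_FP : cntNumX c sx j ∈ FP :=
  comp_mem_FP (append_mem_FP Kannan.zerosFn_mem_FP (const_mem_FP [true]))
    (comp_mem_FP (kF_mem_FP c sx j) xX_mem_FP)

/-- `initX ∈ FP`. [folklore] -/
theorem initX_mem_FP : initX c sx j ∈ FP :=
  fanoutFn_mem_FP (PolyTimeComputable.id _) (fanoutFn_mem_FP (cntNumX_mem_FP c sx j) (const_mem_FP _))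

/-- **`accX ∈ FP`** (fold loop with an additive operation and a clipped piece).
[cite: AroraBarakCC2009, §1.3 (bounded loops)] -/
theorem accX_mem_FP (hRef : Ref ∈ Classes.P) (hF : F ∈ FP) : accX Ref F mv Nb c sx j ∈ FP :=
  comp_mem_FP (sndPow_mem_FP 2)
    (comp_mem_FP (foldLoop_clipF_mem_FP 1 addFn_mem_FP length_addFn_le (pieceZ_mem_FP mv Nb c sx j hRef hF) _)
      (initX_mem_FP c sx j))

/-- `verdictX ∈ FP`. [folklore] -/
theorem verdictX_mem_FP (hRef : Ref ∈ Classes.P) (hF : F ∈ FP) : verdictX Ref F mv Nb c sx j ∈ FP :=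
  comp_mem_FP ltFn_mem_FP (fanoutFn_mem_FP (cntNumX_mem_FP c sx j)
    (comp_mem_FP addFn_mem_FP
      (fanoutFn_mem_FP (accX_mem_FP mv Nb c sx j hRef hF) (accX_mem_FP mv Nb c sx j hRef hF))))

/-- `mkX ∈ FP`. [folklore] -/
theorem mkX_mem_FP : mkX ∈ FP :=
  fanoutFn_mem_FP (comp_mem_FP sndF_mem_FP (comp_mem_FP fstF_mem_FP sndF_mem_FP))
    (fanoutFn_mem_FP
      (fanoutFn_mem_FP (comp_mem_FP fstF_mem_FP (comp_mem_FP fstF_mem_FP (comp_mem_FP fstF_mem_FP sndF_mem_FP)))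
        (comp_mem_FP sndF_mem_FP sndF_mem_FP))
      (comp_mem_FP PRelSigma.tail_mem_FP fstF_mem_FP))

/-- **`postF ∈ FP`** for `Ref ∈ P`, `F ∈ FP`. [cite: AroraBarakCC2009, §1.3] -/
theorem postF_mem_FP (hRef : Ref ∈ Classes.P) (hF : F ∈ FP) : postF Ref F mv Nb c sx j ∈ FP :=
  iteFn_mem_FP (comp_mem_FP take1Fn_mem_FP fstF_mem_FP)
    (comp_mem_FP (verdictX_mem_FP mv Nb c sx j hRef hF) mkX_mem_FP) (const_mem_FP _)

/-! #### Values -/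

variable (Ref F)
variable (P x y t : List Bool)

/-- The record. [folklore] -/
abbrev recX : List Bool := boolPair P (boolPair (boolPair x y) t)

/-- Field `x` on a piece argument. [folklore] -/
@[simp] theorem xZ_rec (i : List Bool) : xZ (boolPair (recX P x y t) i) = x := by simp [xZ, fstF, sndF]
/-- Field `y` on a piece argument. [folklore] -/
@[simp] theorem yZ_rec (i : List Bool) : yZ (boolPair (recX P x y t) i) = y := by simp [yZ, fstF, sndF]
/-- Field `t` on a piece argument. [folklore] -/
@[simp] theorem tZ_rec (i : List Bool) : tZ (boolPair (recX P x y t) i) = t := by simp [tZ, fstF, sndF]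
/-- The index on a piece argument. [folklore] -/
@[simp] theorem iZ_rec (i : List Bool) : iZ (boolPair (recX P x y t) i) = i := by simp [iZ, sndF]
/-- Field `x` on a record. [folklore] -/
@[simp] theorem xX_rec : xX (recX P x y t) = x := by simp [xX, fstF, sndF]

/-- The seed length at input length `N`: `c m(N)^{sx}` (so `2^{c m^{sx}}` seeds). [folklore] -/
abbrev seedLen (N : ℕ) : ℕ := c * (Nat.sqrt^[j] N) ^ sx

/-- Value of `seedZ` in round `i`. [folklore] -/
theorem seedZ_rec (i : ℕ) :
    seedZ c sx j (boolPair (recX P x y t) (ones i)) = List.takeD (seedLen c sx j x.length) (encodeNat i) false := by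
  simp [seedZ, ones]

/-- Value of `outZ` in round `i`. [folklore] -/
theorem outZ_rec (i : ℕ) :
    outZ F Nb c sx j (boolPair (recX P x y t) (ones i)) =
      F (boolPair t (boolPair (ones (Nb.eval x.length))
        (List.takeD (seedLen c sx j x.length) (encodeNat i) false))) := by
  simp [outZ, seedZ_rec]

/-- Value of `coinsZ` in round `i`. [folklore] -/
theorem coinsZ_rec (i : ℕ) :
    coinsZ F mv Nb c sx j (boolPair (recX P x y t) (ones i)) = List.takeD (mv.eval x.length)
      (F (boolPair t (boolPair (ones (Nb.eval x.length))
        (List.takeD (seedLen c sx j x.length) (encodeNat i) false)))) false := by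
  simp [coinsZ, outZ_rec, ones]

/-- **Value of the piece of round `i`**: the bit `[⟨x, enc (y, coinsᵢ)⟩ ∈ Ref]`. [folklore] -/
theorem pieceZ_rec (i : ℕ) :
    pieceZ Ref F mv Nb c sx j (boolPair (recX P x y t) (ones i)) =
      [Ref.boolIndicator (boolPair x (encMoves [y, List.takeD (mv.eval x.length)
        (F (boolPair t (boolPair (ones (Nb.eval x.length))
          (List.takeD (seedLen c sx j x.length) (encodeNat i) false)))) false]))] := by
  simp only [pieceZ, Function.comp_apply, fanoutFn_apply, xZ_rec, yZ_rec, coinsZ_rec, encodeBool]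
  congr 1
  change (Ref.boolIndicator ∘ AMTwo.toRefFn) _ = _
  rw [Function.comp_apply, AMTwo.toRefFn_apply]

/-- The piece is one symbol long on every input. [folklore] -/
theorem length_pieceZ (w : List Bool) : (pieceZ Ref F mv Nb c sx j w).length = 1 := by
  simp [pieceZ, encodeBool]

/-- Value of `cntNumX`: the numeral of `2^{c m^{sx}}`. [folklore] -/
theorem cntNumX_rec : cntNumX c sx j (recX P x y t) = encodeNat (2 ^ seedLen c sx j x.length) := by
  simp [cntNumX, ones, Com.encodeNat_two_pow]

/-- Value of `initX`. [folklore] -/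
theorem initX_rec : initX c sx j (recX P x y t) =
    boolPair (recX P x y t) (boolPair (encodeNat (2 ^ seedLen c sx j x.length)) (boolPair (ones 0) (encodeNat 0))) := by
  simp [initX, cntNumX_rec, ones]
  rfl

/-- **The number of accepting seeds** for the table `t`, input `x` and message `y`: the number of
`i < 2^{c m^{sx}}` whose seed `ρᵢ` makes Arthur accept. [cite: ImpagliazzoKabanetsWigderson2002, Thm. 12 (proof)] -/
def accCount : ℕ :=
  ∑ i ∈ Finset.range (2 ^ seedLen c sx j x.length),
    (Ref.boolIndicator (boolPair x (encMoves [y, List.takeD (mv.eval x.length)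
      (F (boolPair t (boolPair (ones (Nb.eval x.length))
        (List.takeD (seedLen c sx j x.length) (encodeNat i) false)))) false]))).toNat

/-- **Value of `accX`** on a record whose ruler is long enough for all `2^{c m^{sx}}` rounds.
[cite: AroraBarakCC2009, Lemma 20.3 (proof)] -/
theorem accX_rec (hP : 2 ^ seedLen c sx j x.length ≤ P.length) :
    accX Ref F mv Nb c sx j (recX P x y t) = encodeNat (accCount Ref F mv Nb c sx j x y t) := by
  have hk : 2 ^ seedLen c sx j x.length ≤ (X : Polynomial ℕ).eval (recX P x y t).length := by
    rw [eval_X]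
    refine hP.trans ?_
    simp only [length_boolPair]; omega
  simp only [accX, Function.comp_apply, initX_rec]
  rw [foldLoop_apply addFn _ hk 0 (encodeNat 0), sndPow_succ_boolPair, sndPow_succ_boolPair,
    sndPow_zero_boolPair, foldAcc_clipF (fun i _ _ => by rw [length_pieceZ]; omega), foldAcc_addFn]
  have hb : ∀ b : Bool, bitsToNat [b] = b.toNat := fun b => by rw [bitsToNat_cons]; simp
  simp only [zero_add, accCount, pieceZ_rec, hb]

/-- **Value of the verdict** on a record with a long enough ruler: `[2^{c m^{sx}} < 2 · accCount]`.
[cite: AroraBarakCC2009, Lemma 20.3 (proof)] -/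
theorem verdictX_rec (hP : 2 ^ seedLen c sx j x.length ≤ P.length) :
    verdictX Ref F mv Nb c sx j (recX P x y t) =
      [decide (2 ^ seedLen c sx j x.length < 2 * accCount Ref F mv Nb c sx j x y t)] := by
  simp [verdictX, cntNumX_rec, accX_rec (hP := hP), two_mul]

/-- Value of `mkX` on a stage-4 input with an accepting code. [folklore] -/
theorem mkX_apply (w : List Bool) (code : List Bool) :
    mkX (boolPair code (boolPair (boolPair w P) y)) = recX P (fstF w) y code.tail := by
  simp [mkX, fstF, sndF]

/-- **Value of stage 4 on a rejecting code**: reject. [cite: ImpagliazzoKabanetsWigderson2002, Thm. 12 (proof)] -/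
theorem postF_none (w : List Bool) :
    postF Ref F mv Nb c sx j (boolPair (encodeTableOpt none) (boolPair (boolPair w P) y)) = [false] := by
  rw [postF, iteFn_apply_false]
  simp [take1Fn, fstF, encodeTableOpt]

/-- **Value of stage 4 on an accepting code** with table `t` (ruler long enough): the verdict.
[cite: ImpagliazzoKabanetsWigderson2002, Thm. 12 (proof)] -/
theorem postF_some (w : List Bool) (hP : 2 ^ seedLen c sx j (fstF w).length ≤ P.length) :
    postF Ref F mv Nb c sx j (boolPair (encodeTableOpt (some t)) (boolPair (boolPair w P) y)) =
      [decide (2 ^ seedLen c sx j (fstF w).length < 2 * accCount Ref F mv Nb c sx j (fstF w) y t)] := by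
  rw [postF, iteFn_apply_true (by simp [take1Fn, fstF, encodeTableOpt]), Function.comp_apply,
    mkX_apply P y w, show (encodeTableOpt (some t)).tail = t from rfl, verdictX_rec (hP := hP)]

end Post

/-! ### Stage 2: the preparation -/

section Pre

variable (mv : Polynomial ℕ) (cG j : ℕ)

/-! Stage 2 works on `R₂ = ⟨⟨w, P⟩, u'⟩`: the input word `w` (nominally `⟨x, α⟩`), the pad `P` and the
kept witness `u'` (nominally `⟨y', g'⟩`). -/

/-- Field `w` of `⟨⟨w, P⟩, u'⟩`. [folklore] -/
def wR : List Bool → List Bool := fstF ∘ fstF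
/-- Field `P`. [folklore] -/
def PR : List Bool → List Bool := sndF ∘ fstF
/-- Field `u'`. [folklore] -/
def uR : List Bool → List Bool := sndF
/-- The input `x = fst w`. [folklore] -/
def xR : List Bool → List Bool := fstF ∘ wR
/-- The advice `α = snd w`. [folklore] -/
def aR : List Bool → List Bool := sndF ∘ wR
/-- Merlin's message, normalised to the move length: `y = takeD mv(|x|) (fst u')`. [folklore] -/
def yR : List Bool → List Bool := fstF ∘ padTakeFn ∘ fanoutFn (polyFn mv ∘ xR) (fstF ∘ uR)
/-- The generator's guess, cut to the admissible length: `g = (snd u') ↾ (c_G 2^{c_G m} + c_G)`. [folklore] -/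
def gR : List Bool → List Bool := takeFn ∘ fanoutFn (bgF cG j ∘ fanoutFn PR xR) (sndF ∘ uR)
/-- The generator's input `⟨⟨1^m, α⟩, g⟩`. [cite: ImpagliazzoKabanetsWigderson2002, §2.2] -/
def genInR : List Bool → List Bool := fanoutFn (fanoutFn (scaleF j ∘ xR) aR) (gR cG j)
/-- The context `⟨⟨w, P⟩, y⟩` carried past the generator. [folklore] -/
def ctxR : List Bool → List Bool := fanoutFn fstF (yR mv)
/-- **Stage 2**: `⟨⟨w, P⟩, u'⟩ ↦ ⟨⟨⟨1^m, α⟩, g⟩, ⟨⟨w, P⟩, y⟩⟩`. [cite: ImpagliazzoKabanetsWigderson2002, Thm. 12 (proof)] -/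
def preF : List Bool → List Bool := fanoutFn (genInR cG j) (ctxR mv)

/-- `wR ∈ FP`. [folklore] -/
theorem wR_mem_FP : wR ∈ FP := comp_mem_FP fstF_mem_FP fstF_mem_FP
/-- `PR ∈ FP`. [folklore] -/
theorem PR_mem_FP : PR ∈ FP := comp_mem_FP sndF_mem_FP fstF_mem_FP
/-- `uR ∈ FP`. [folklore] -/
theorem uR_mem_FP : uR ∈ FP := sndF_mem_FP
/-- `xR ∈ FP`. [folklore] -/
theorem xR_mem_FP : xR ∈ FP := comp_mem_FP fstF_mem_FP wR_mem_FP
/-- `aR ∈ FP`. [folklore] -/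
theorem aR_mem_FP : aR ∈ FP := comp_mem_FP sndF_mem_FP wR_mem_FP

/-- `yR ∈ FP`. [folklore] -/
theorem yR_mem_FP : yR mv ∈ FP :=
  comp_mem_FP fstF_mem_FP (comp_mem_FP padTakeFn_mem_FP
    (fanoutFn_mem_FP (comp_mem_FP (polyFn_mem_FP mv) xR_mem_FP) (comp_mem_FP fstF_mem_FP uR_mem_FP)))

/-- `gR ∈ FP`. [folklore] -/
theorem gR_mem_FP : gR cG j ∈ FP :=
  comp_mem_FP takeFn_mem_FP (fanoutFn_mem_FP (comp_mem_FP (bgF_mem_FP cG j) (fanoutFn_mem_FP PR_mem_FP xR_mem_FP))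
    (comp_mem_FP sndF_mem_FP uR_mem_FP))

/-- `genInR ∈ FP`. [folklore] -/
theorem genInR_mem_FP : genInR cG j ∈ FP :=
  fanoutFn_mem_FP (fanoutFn_mem_FP (comp_mem_FP (scaleF_mem_FP j) xR_mem_FP) aR_mem_FP) (gR_mem_FP cG j)

/-- `ctxR ∈ FP`. [folklore] -/
theorem ctxR_mem_FP : ctxR mv ∈ FP := fanoutFn_mem_FP fstF_mem_FP (yR_mem_FP mv)

/-- **`preF ∈ FP`.** [cite: AroraBarakCC2009, §1.3] -/
theorem preF_mem_FP : preF mv cG j ∈ FP := fanoutFn_mem_FP (genInR_mem_FP cG j) (ctxR_mem_FP mv)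

variable (w P u' : List Bool)

/-- Field `w` on a stage-2 input. [folklore] -/
@[simp] theorem wR_apply : wR (boolPair (boolPair w P) u') = w := by simp [wR]
/-- Field `P` on a stage-2 input. [folklore] -/
@[simp] theorem PR_apply : PR (boolPair (boolPair w P) u') = P := by simp [PR]
/-- Field `u'` on a stage-2 input. [folklore] -/
@[simp] theorem uR_apply : uR (boolPair (boolPair w P) u') = u' := by simp [uR]
/-- The input `x` on a stage-2 input. [folklore] -/
@[simp] theorem xR_apply : xR (boolPair (boolPair w P) u') = fstF w := by simp [xR]
/-- The advice `α` on a stage-2 input. [folklore] -/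
@[simp] theorem aR_apply : aR (boolPair (boolPair w P) u') = sndF w := by simp [aR]

/-- Value of `yR`. [folklore] -/
@[simp] theorem yR_apply :
    yR mv (boolPair (boolPair w P) u') = List.takeD (mv.eval (fstF w).length) (fstF u') false := by
  simp [yR, ones]

/-- Value of `gR`. [folklore] -/
@[simp] theorem gR_apply :
    gR cG j (boolPair (boolPair w P) u') = (sndF u').take (bgF cG j (boolPair P (fstF w))).length := by
  simp [gR]

/-- **Value of stage 2.** [folklore] -/
theorem preF_apply : preF mv cG j (boolPair (boolPair w P) u') =
    boolPair
      (boolPair (boolPair (ones (Nat.sqrt^[j] (fstF w).length)) (sndF w))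
        ((sndF u').take (bgF cG j (boolPair P (fstF w))).length))
      (boolPair (boolPair w P) (List.takeD (mv.eval (fstF w).length) (fstF u') false)) := by
  simp [preF, genInR, ctxR]

/-- The admissible guess length measured on any ruler is at most the true one. [folklore] -/
theorem length_bgF_boolPair_le (x : List Bool) :
    (bgF cG j (boolPair P x)).length ≤ cG * 2 ^ (cG * Nat.sqrt^[j] x.length) + cG := by
  rw [bgF, Function.comp_apply, Function.comp_apply, fanoutFn_apply, fstF_boolPair, Function.comp_apply,
    sndF_boolPair, gExpNumF_apply, binToUnaryFn_boolPair, bitsToNat_encodeNat]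
  simp only [onesMulFn, ones, List.length_append, List.length_replicate]
  have := min_le_left (2 ^ (cG * Nat.sqrt^[j] x.length)) P.length
  nlinarith

end Pre

/-! ### Stage 1: the clock -/

section Clock

variable (mv : Polynomial ℕ) (c cG sx j : ℕ)

/-- The padding exponent next to the word: `w ↦ ⟨1^e, w⟩`, `e = (c + c_G) m(|fst w|)²`. [folklore] -/
def expoF : List Bool → List Bool := fanoutFn (eF c cG sx j ∘ fstF) fun w => w

/-- The kept witness length in unary, from `r = ⟨⟨1^e, P⟩, w⟩`: `1^{2 mv(N) + 2} ++ 1^{c_G 2^{c_G m} + c_G}`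
(the power of two measured on the pad `P`). [folklore] -/
def lenUF : List Bool → List Bool :=
  appF ∘ fanoutFn (polyFn (2 * mv + 2) ∘ fstF ∘ sndF) (bgF cG j ∘ fanoutFn (sndF ∘ fstF) (fstF ∘ sndF))

/-- The rearrangement `⟨⟨1^e, P⟩, w⟩ ↦ ⟨⟨w, P⟩, 1^U⟩`. [folklore] -/
def arrF : List Bool → List Bool := fanoutFn (fanoutFn sndF (sndF ∘ fstF)) (lenUF mv cG j)

/-- `expoF ∈ FP`. [folklore] -/
theorem expoF_mem_FP : expoF c cG sx j ∈ FP :=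
  fanoutFn_mem_FP (comp_mem_FP (eF_mem_FP c cG sx j) fstF_mem_FP) (PolyTimeComputable.id _)

/-- `lenUF ∈ FP`. [folklore] -/
theorem lenUF_mem_FP : lenUF mv cG j ∈ FP :=
  comp_mem_FP appF_mem_FP
    (fanoutFn_mem_FP (comp_mem_FP (polyFn_mem_FP _) (comp_mem_FP fstF_mem_FP sndF_mem_FP))
      (comp_mem_FP (bgF_mem_FP cG j)
        (fanoutFn_mem_FP (comp_mem_FP sndF_mem_FP fstF_mem_FP) (comp_mem_FP fstF_mem_FP sndF_mem_FP))))

/-- `arrF ∈ FP`. [folklore] -/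
theorem arrF_mem_FP : arrF mv cG j ∈ FP :=
  fanoutFn_mem_FP (fanoutFn_mem_FP sndF_mem_FP (comp_mem_FP sndF_mem_FP fstF_mem_FP)) (lenUF_mem_FP mv cG j)

/-- The padding exponent of a word. [folklore] -/
abbrev expo (w : List Bool) : ℕ := (c + cG) * (Nat.sqrt^[j] (fstF w).length) ^ sx

/-- The kept witness length at input length `N`: `2 mv(N) + 2 + (c_G 2^{c_G m(N)} + c_G)`. [folklore] -/
abbrev keptLen (N : ℕ) : ℕ := (2 * mv + 2).eval N + (cG * 2 ^ (cG * Nat.sqrt^[j] N) + cG)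

/-- `c_G m ≤ (c + c_G) m^{sx}`: the pad `1^{2^e+1}` is a long enough ruler for `2^{c_G m}`. [folklore] -/
theorem gExp_le_expo (hsx : 1 ≤ sx) (m : ℕ) : cG * m ≤ (c + cG) * m ^ sx := by
  have hm : m ≤ m ^ sx := by
    rcases Nat.eq_zero_or_pos m with rfl | hm
    · simp
    · calc m = m ^ 1 := (pow_one m).symm
        _ ≤ m ^ sx := Nat.pow_le_pow_right hm hsx
  calc cG * m ≤ cG * m ^ sx := Nat.mul_le_mul_left _ hm
    _ ≤ (c + cG) * m ^ sx := Nat.mul_le_mul_right _ (Nat.le_add_left _ _)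

/-- `2^{c_G m} ≤ 2^e + 1`. [folklore] -/
theorem two_pow_gExp_le (hsx : 1 ≤ sx) (w : List Bool) :
    2 ^ (cG * Nat.sqrt^[j] (fstF w).length) ≤ (ones (2 ^ expo c cG sx j w + 1)).length := by
  simp only [ones, List.length_replicate]
  exact (Nat.pow_le_pow_right (by norm_num) (gExp_le_expo c cG sx hsx _)).trans (Nat.le_succ _)

/-- Value of `expoF`. [folklore] -/
@[simp] theorem expoF_apply (w : List Bool) : expoF c cG sx j w = boolPair (ones (expo c cG sx j w)) w := by
  simp [expoF]

/-- Value of `arrF` on the clocked word. [folklore] -/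
theorem arrF_apply (hsx : 1 ≤ sx) (w : List Bool) :
    arrF mv cG j (boolPair (boolPair (ones (expo c cG sx j w)) (ones (2 ^ expo c cG sx j w + 1))) w) =
      boolPair (boolPair w (ones (2 ^ expo c cG sx j w + 1))) (ones (keptLen mv cG j (fstF w).length)) := by
  have hb := bgF_apply cG j (ones (2 ^ expo c cG sx j w + 1)) (fstF w) (two_pow_gExp_le c cG sx j hsx w)
  simp only [arrF, lenUF, Function.comp_apply, fanoutFn_apply, sndF_boolPair, fstF_boolPair, polyFn_apply, hb,
    appF_boolPair]
  simp only [ones, ← List.replicate_add]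

/-- **The clock machine**: `w ↦ ⟨⟨w, 1^{2^e+1}⟩, 1^U⟩` within `c₀ (2^e + |w|)^{c₀} + c₀` steps (the
exponential clock `expClock 1 1` under `mapFstAux`, between two `FP` rearrangements).
[cite: AroraBarakCC2009, §1.3] -/
theorem exists_clock_machine (hsx : 1 ≤ sx) :
    ∃ (c₀ : ℕ) (N₁ : TM2ComputableAux Bool Bool), ∀ w : List Bool,
      N₁.OutputsWithin w
        (boolPair (boolPair w (ones (2 ^ expo c cG sx j w + 1))) (ones (keptLen mv cG j (fstF w).length)))
        (c₀ * (2 ^ expo c cG sx j w + w.length) ^ c₀ + c₀) := by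
  obtain ⟨pE, ME, hME⟩ := expoF_mem_FP c cG sx j
  obtain ⟨C₁, Ck, hCk⟩ := exists_timeComputable_expClock 1 (k := 1) le_rfl
  obtain ⟨pA, MA, hMA⟩ := arrF_mem_FP mv cG j
  obtain ⟨c₀, hc₀⟩ := EasyWitness.exists_const_eval_le
    (pE + (Polynomial.C C₁ * X + Polynomial.C C₁ + Polynomial.C 16 * X + Polynomial.C 24) +
      pA.comp (Polynomial.C 8 * X + Polynomial.C 12))
  refine ⟨c₀, ME.comp ((mapFstAux Ck).comp MA), fun w => ?_⟩
  set e := expo c cG sx j w with he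
  set Y := 2 ^ e + w.length with hY
  have heY : e ≤ 2 ^ e := Nat.lt_two_pow_self.le
  have hY1 : 1 ≤ Y := le_add_right Nat.one_le_two_pow
  -- stage a: `w ↦ ⟨1^e, w⟩`
  have h₁ : ME.OutputsWithin w (boolPair (ones e) w) (pE.eval w.length) := by
    have := hME w; rwa [expoF_apply] at this
  -- stage b: the exponential clock on `1^e`, under `mapFstAux`
  have hclk : Ck.OutputsWithin (boolUnpair (boolPair (ones e) w)).1 (boolPair (ones e) (ones (2 ^ e + 1)))
      (C₁ * 2 ^ e + C₁) := by
    rw [boolUnpair_boolPair]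
    have h := hCk (ones e)
    simp only [expClock, id, one_mul, pow_one, ones, List.length_replicate] at h
    simpa only [ones, pow_one] using h
  have h₂ := outputsWithin_mapFstAux Ck hclk
  rw [readRest_boolPair] at h₂
  -- stage c: the rearrangement
  set Z := boolPair (boolPair (ones e) (ones (2 ^ e + 1))) w with hZ
  have h₃ : MA.OutputsWithin Z (arrF mv cG j Z) (pA.eval Z.length) := hMA Z
  rw [hZ, arrF_apply mv c cG sx j hsx] at h₃
  refine (Turing.TM2ComputableAux.comp_outputsWithin _ _ h₁
    (Turing.TM2ComputableAux.comp_outputsWithin _ _ h₂ h₃)).mono ?_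
  have hL₀ : (boolPair (ones e) w).length = 2 * e + 2 + w.length := by
    simp only [length_boolPair, ones, List.length_replicate]
  have hL₁ : (boolPair (ones e) (ones (2 ^ e + 1))).length = 2 * e + 2 + (2 ^ e + 1) := by
    simp only [length_boolPair, ones, List.length_replicate]
  have hL₂ : (boolPair (boolPair (ones e) (ones (2 ^ e + 1))) w).length =
      2 * (2 * e + 2 + (2 ^ e + 1)) + 2 + w.length := by
    simp only [length_boolPair, ones, List.length_replicate]
  have hpE : pE.eval w.length ≤ pE.eval Y := TM2Iter.eval_mono _ (Nat.le_add_left _ _)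
  have hpA : pA.eval (boolPair (boolPair (ones e) (ones (2 ^ e + 1))) w).length ≤
      (pA.comp (Polynomial.C 8 * X + Polynomial.C 12)).eval Y := by
    rw [eval_comp, hL₂]
    exact TM2Iter.eval_mono _ (by simp only [eval_add, eval_mul, eval_C, eval_X]; omega)
  have hc := hc₀ Y hY1
  simp only [eval_add, eval_mul, eval_C, eval_X] at hc
  rw [hL₁, hL₀, hL₂] at *
  have h2e : 2 ^ e ≤ Y := Nat.le_add_right _ _
  have hwY : w.length ≤ Y := Nat.le_add_left _ _
  have hC1 : C₁ * 2 ^ e ≤ C₁ * Y := Nat.mul_le_mul_left _ h2e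
  omega

/-- **The truncation stage**: on EVERY pair `⟨w, u⟩` the wrapper outputs `⟨⟨w, 1^{2^e+1}⟩, u ↾ U⟩` within
`c₁ (2^e + |w|)^{c₁} + c₁ + |u|/2` steps (the rest of the witness is read two symbols per step).
[cite: AroraBarakCC2009, §1.3] -/
theorem exists_trunc_machine (hsx : 1 ≤ sx) :
    ∃ (c₁ : ℕ) (Tr : TM2ComputableAux Bool Bool), ∀ w u : List Bool,
      Tr.OutputsWithin (boolPair w u)
        (boolPair (boolPair w (ones (2 ^ expo c cG sx j w + 1))) (u.take (keptLen mv cG j (fstF w).length)))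
        (c₁ * (2 ^ expo c cG sx j w + w.length) ^ c₁ + c₁ + u.length / 2) := by
  obtain ⟨c₀, N₁, hN₁⟩ := exists_clock_machine mv c cG sx j hsx
  obtain ⟨A, hA⟩ := EasyWitness.exists_const_eval_le (2 * mv + 2)
  obtain ⟨c₁, hc₁⟩ := EasyWitness.exists_const_eval_le
    (Polynomial.C c₀ * X ^ c₀ + Polynomial.C c₀ + Polynomial.C (2 * A) * X ^ A + Polynomial.C (2 * A) +
      Polynomial.C (4 * cG + 20) * X + Polynomial.C (4 * cG + 40))
  refine ⟨c₁, truncMapAux N₁, fun w u => ?_⟩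
  have h := outputsWithin_truncMapAux_boolPair N₁ (y := u) (hN₁ w)
  simp only [ones, List.length_replicate] at h
  refine h.mono ?_
  set e := expo c cG sx j w with he
  set Y := 2 ^ e + w.length with hY
  have hY1 : 1 ≤ Y := le_add_right Nat.one_le_two_pow
  have hfst : (fstF w).length ≤ w.length := length_boolUnpair_fst_le w
  have h2e : 2 ^ e ≤ Y := Nat.le_add_right _ _
  have hwY : w.length ≤ Y := Nat.le_add_left _ _
  have hmv : (2 * mv + 2).eval (fstF w).length ≤ A * Y ^ A + A :=
    (TM2Iter.eval_mono _ (hfst.trans hwY)).trans (hA Y hY1)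
  have hg : cG * 2 ^ (cG * Nat.sqrt^[j] (fstF w).length) + cG ≤ cG * Y + 2 * cG := by
    have h1 := two_pow_gExp_le c cG sx j hsx w
    simp only [ones, List.length_replicate] at h1
    rw [← he] at h1
    have h2 : cG * 2 ^ (cG * Nat.sqrt^[j] (fstF w).length) ≤ cG * (Y + 1) :=
      Nat.mul_le_mul_left _ (h1.trans (by omega))
    have h3 : cG * (Y + 1) = cG * Y + cG := by ring
    omega
  have hc := hc₁ Y hY1
  simp only [eval_add, eval_mul, eval_C, eval_X, eval_pow] at hc
  have ht : (4 * cG + 20) * Y = 4 * (cG * Y) + 20 * Y := by ring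
  have hs : 2 * A * Y ^ A = 2 * (A * Y ^ A) := by ring
  rw [ht, hs] at hc
  simp only [length_boolPair, List.length_replicate, keptLen]
  omega

end Clock

/-! ### The verifier: behaviour and machine -/

section Verifier

variable {a : ℕ → ℕ} (G : TruthTableGenerator a) (Ref : Language Bool) (F : List Bool → List Bool)
  (mv Nb : Polynomial ℕ) (c sx j : ℕ)

/-- **Merlin's message read off the witness** `u` of the word `w`: the first component of the kept
part `u ↾ U`, normalised to the move length `mv(|x|)`, `x = fst w`. [cite: ImpagliazzoKabanetsWigderson2002, Thm. 12 (proof)] -/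
def msgOf (w u : List Bool) : List Bool :=
  List.takeD (mv.eval (fstF w).length) (fstF (u.take (keptLen mv G.c j (fstF w).length))) false

/-- **The generator's guess read off the witness**: the second component of the kept part, cut to
the admissible length `c_G 2^{c_G m} + c_G`. [cite: ImpagliazzoKabanetsWigderson2002, Thm. 12 (proof)] -/
def guessOf (w u : List Bool) : List Bool :=
  (sndF (u.take (keptLen mv G.c j (fstF w).length))).take
    (G.c * 2 ^ (G.c * Nat.sqrt^[j] (fstF w).length) + G.c)

/-- **The behaviour of the verifier** on the word `w` (nominally `⟨x, α⟩`) and the witness `u`: run the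
generator at scale `m = m(|x|)` with advice `α = snd w` on the guess; reject if it rejects; else accept
iff a majority of the `2^{c m^{sx}}` seeds make Arthur accept `⟨x, enc (y, G_t(ρᵢ) ↾ mv(|x|))⟩`.
[cite: ImpagliazzoKabanetsWigderson2002, Thm. 12 (proof)] -/
def verdictBit (w u : List Bool) : Bool :=
  match G.gen (Nat.sqrt^[j] (fstF w).length) (sndF w) (guessOf G mv j w u) with
  | none => false
  | some t => decide (2 ^ seedLen c sx j (fstF w).length <
      2 * accCount Ref F mv Nb c sx j (fstF w) (msgOf G mv j w u) t)

/-- The guess is admissible for the generator. [folklore] -/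
theorem length_guessOf_le (w u : List Bool) :
    (guessOf G mv j w u).length ≤ G.c * 2 ^ (G.c * Nat.sqrt^[j] (fstF w).length) + G.c := by
  unfold guessOf; exact List.length_take_le _ _

/-- The message has the move length. [folklore] -/
@[simp] theorem length_msgOf (w u : List Bool) : (msgOf G mv j w u).length = mv.eval (fstF w).length := by
  unfold msgOf; exact List.takeD_length _ _ _

variable {Ref F}

/-- **The body** `M_pre ∘ mapFstAux G.machine ∘ M_post` on `⟨⟨w, P⟩, u'⟩` (any pad `P`): it outputs stage 4's
value on the generator's code within `Q(|input| + T_G)` steps, `T_G = c_G (2^m + |α|)^{c_G} + c_G` the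
generator's time (the guess handed to it is always admissible). [cite: ImpagliazzoKabanetsWigderson2002, Thm. 12 (proof)]
[cite: AroraBarakCC2009, §1.3] -/
theorem exists_body_machine (hRef : Ref ∈ Classes.P) (hF : F ∈ FP) :
    ∃ (Q : Polynomial ℕ) (S : TM2ComputableAux Bool Bool), ∀ w P u' : List Bool,
      S.OutputsWithin (boolPair (boolPair w P) u')
        (postF Ref F mv Nb c sx j
          (boolPair
            (encodeTableOpt (G.gen (Nat.sqrt^[j] (fstF w).length) (sndF w)
              ((sndF u').take (bgF G.c j (boolPair P (fstF w))).length)))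
            (boolPair (boolPair w P) (List.takeD (mv.eval (fstF w).length) (fstF u') false))))
        (Q.eval ((boolPair (boolPair w P) u').length +
          (G.c * (2 ^ Nat.sqrt^[j] (fstF w).length + (sndF w).length) ^ G.c + G.c))) := by
  obtain ⟨pF, MF, hMF⟩ := preF_mem_FP mv G.c j
  obtain ⟨pG, MG, hMG⟩ := postF_mem_FP mv Nb c sx j hRef hF
  set DF := TM2Comp.machinePushBound MF.tm with hDF
  set DG := TM2Comp.machinePushBound G.machine.tm with hDG
  -- the polynomial: `Lp` bounds `|preF R|`, `Cp` bounds `|code|`, in `Z = |R| + T_G`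
  set Lp : Polynomial ℕ := X + Polynomial.C DF * pF with hLp
  set Cp : Polynomial ℕ := Lp + Polynomial.C DG * X with hCp
  refine ⟨pF + X + 3 * Cp + 2 * Lp + 6 + pG.comp (2 * Cp + 2 + Lp),
    MF.comp ((mapFstAux G.machine).comp MG), fun w P u' => ?_⟩
  set R := boolPair (boolPair w P) u' with hR
  set m := Nat.sqrt^[j] (fstF w).length with hm
  set α := sndF w with hα
  set g := (sndF u').take (bgF G.c j (boolPair P (fstF w))).length with hg
  set y := List.takeD (mv.eval (fstF w).length) (fstF u') false with hy
  set TG := G.c * (2 ^ m + α.length) ^ G.c + G.c with hTG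
  set Z := R.length + TG with hZ
  -- stage 2
  have h₁ : MF.OutputsWithin R (preF mv G.c j R) (pF.eval R.length) := hMF R
  have hℓ₁ : (preF mv G.c j R).length ≤ R.length + DF * pF.eval R.length :=
    TM2Comp.length_le_of_outputsWithin MF h₁
  have hpre : preF mv G.c j R = boolPair (boolPair (boolPair (ones m) α) g) (boolPair (boolPair w P) y) := by
    rw [hR, preF_apply]
  -- stage 3: the generator under `mapFstAux`
  have hgl : g.length ≤ G.c * 2 ^ (G.c * m) + G.c :=
    (List.length_take_le _ _).trans (length_bgF_boolPair_le G.c j P (fstF w))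
  have hGen : G.machine.OutputsWithin (boolUnpair (preF mv G.c j R)).1
      (encodeTableOpt (G.gen m α g)) TG := by
    rw [hpre, boolUnpair_boolPair]
    have h := G.outputsWithin m α g hgl
    rwa [OracleCompose.unaryEncodeNat_eq_replicate] at h
  have h₂ := outputsWithin_mapFstAux G.machine hGen
  have hcode : (encodeTableOpt (G.gen m α g)).length ≤ (boolPair (boolPair (ones m) α) g).length + DG * TG := by
    have h := G.outputsWithin m α g hgl
    rw [OracleCompose.unaryEncodeNat_eq_replicate] at h
    exact TM2Comp.length_le_of_outputsWithin G.machine h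
  rw [hpre, readRest_boolPair] at h₂
  rw [← hpre] at h₂
  -- stage 4
  set mid := boolPair (encodeTableOpt (G.gen m α g)) (boolPair (boolPair w P) y) with hmid
  have h₃ : MG.OutputsWithin mid (postF Ref F mv Nb c sx j mid) (pG.eval mid.length) := hMG mid
  have h := Turing.TM2ComputableAux.comp_outputsWithin _ _ h₁
    (Turing.TM2ComputableAux.comp_outputsWithin _ _ h₂ h₃)
  refine h.mono ?_
  -- bookkeeping in `Z`
  have hRZ : R.length ≤ Z := Nat.le_add_right _ _
  have hpF : pF.eval R.length ≤ pF.eval Z := TM2Iter.eval_mono _ hRZ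
  have hL : (preF mv G.c j R).length ≤ Lp.eval Z := by
    simp only [hLp, eval_add, eval_X, eval_mul, eval_C]
    nlinarith [hℓ₁, hpF]
  have hgen_le : (boolPair (boolPair (ones m) α) g).length ≤ (preF mv G.c j R).length := by
    rw [hpre]; simp only [length_boolPair]; omega
  have hctx_le : (boolPair (boolPair w P) y).length ≤ (preF mv G.c j R).length := by
    rw [hpre]; simp only [length_boolPair]; omega
  have hC : (encodeTableOpt (G.gen m α g)).length ≤ Cp.eval Z := by
    simp only [hCp, eval_add, eval_X, eval_mul, eval_C]
    have : DG * TG ≤ DG * Z := Nat.mul_le_mul_left _ (Nat.le_add_left _ _)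
    nlinarith [hcode, hgen_le, hL]
  have hmidl : mid.length ≤ (2 * Cp + 2 + Lp).eval Z := by
    have e1 : mid.length = 2 * (encodeTableOpt (G.gen m α g)).length + 2 + (boolPair (boolPair w P) y).length := by
      rw [hmid, length_boolPair]
    simp only [eval_add, eval_mul, eval_ofNat]
    rw [e1]
    nlinarith [hC, hctx_le, hL]
  have hpG : pG.eval mid.length ≤ (pG.comp (2 * Cp + 2 + Lp)).eval Z := by
    rw [eval_comp]; exact TM2Iter.eval_mono _ hmidl
  have hTGZ : TG ≤ Z := Nat.le_add_left _ _
  simp only [eval_add, eval_mul, eval_X, eval_ofNat]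
  nlinarith [hpF, hL, hC, hpG, hTGZ]

/-- `2^{c m^{sx}} ≤ 2^e + 1`: the genuine pad gives the verdict room for all seeds. [folklore] -/
theorem two_pow_seedLen_le_pad (cG : ℕ) (w : List Bool) :
    2 ^ seedLen c sx j (fstF w).length ≤ (ones (2 ^ expo c cG sx j w + 1)).length := by
  simp only [ones, List.length_replicate, seedLen, expo]
  exact (Nat.pow_le_pow_right (by norm_num) (Nat.mul_le_mul_right _ (Nat.le_add_right _ _))).trans
    (Nat.le_succ _)

/-- The generator's time at scale `m(|x|)` is polynomial in `2^e + |w|`. [folklore] -/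
theorem genTime_le (hsx : 1 ≤ sx) (w : List Bool) :
    G.c * (2 ^ Nat.sqrt^[j] (fstF w).length + (sndF w).length) ^ G.c + G.c ≤
      G.c * (2 ^ expo c G.c sx j w + w.length) ^ G.c + G.c := by
  rcases Nat.eq_zero_or_pos G.c with h0 | hpos
  · rw [h0]; simp
  · have hm : Nat.sqrt^[j] (fstF w).length ≤ expo c G.c sx j w := by
      have h1 := gExp_le_expo c G.c sx hsx (Nat.sqrt^[j] (fstF w).length)
      have h2 : Nat.sqrt^[j] (fstF w).length ≤ G.c * Nat.sqrt^[j] (fstF w).length :=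
        Nat.le_mul_of_pos_left _ hpos
      exact h2.trans h1
    have hs : (sndF w).length ≤ w.length := by
      have := length_boolUnpair_parts_le w
      simp only [sndF]; omega
    have hb : 2 ^ Nat.sqrt^[j] (fstF w).length + (sndF w).length ≤ 2 ^ expo c G.c sx j w + w.length :=
      Nat.add_le_add (Nat.pow_le_pow_right (by norm_num) hm) hs
    exact Nat.add_le_add_right (Nat.mul_le_mul_left _ (Nat.pow_le_pow_left hb _)) _

/-- **The verifier machine**: on EVERY pair `⟨w, u⟩` the composite `truncMapAux N₁ ∘ body` outputs the
bit `[verdictBit w u]` within `c₂ (2^e + |w|)^{c₂} + c₂ + |u|/2` steps, `e = (c + c_G) m(|fst w|)²`.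
[cite: ImpagliazzoKabanetsWigderson2002, Thm. 12 (proof)] [cite: AroraBarakCC2009, §1.3] -/
theorem exists_verifier (hsx : 1 ≤ sx) (hRef : Ref ∈ Classes.P) (hF : F ∈ FP) :
    ∃ (c₂ : ℕ) (V : TM2ComputableAux Bool Bool), ∀ w u : List Bool,
      V.OutputsWithin (boolPair w u) [verdictBit G Ref F mv Nb c sx j w u]
        (c₂ * (2 ^ expo c G.c sx j w + w.length) ^ c₂ + c₂ + u.length / 2) := by
  obtain ⟨c₁, Tr, hTr⟩ := exists_trunc_machine mv c G.c sx j hsx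
  obtain ⟨Q, S, hS⟩ := exists_body_machine G mv Nb c sx j hRef hF
  obtain ⟨A, hA⟩ := EasyWitness.exists_const_eval_le (2 * mv + 2)
  -- `|R₂| + T_G ≤ B(Y)`, `Y = 2^e + |w|`
  set B : Polynomial ℕ := 6 * X + 8 + (Polynomial.C A * X ^ A + Polynomial.C A + Polynomial.C G.c * X +
    Polynomial.C (2 * G.c)) + (Polynomial.C G.c * X ^ G.c + Polynomial.C G.c) with hB
  obtain ⟨c₂, hc₂⟩ := EasyWitness.exists_const_eval_le (Polynomial.C c₁ * X ^ c₁ + Polynomial.C c₁ + Q.comp B)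
  refine ⟨c₂, Tr.comp S, fun w u => ?_⟩
  set e := expo c G.c sx j w with he
  set Y := 2 ^ e + w.length with hY
  set U := keptLen mv G.c j (fstF w).length with hU
  set Pd := ones (2 ^ e + 1) with hPd
  have hY1 : 1 ≤ Y := le_add_right Nat.one_le_two_pow
  have h₁ := hTr w u
  rw [← he, ← hU, ← hY] at h₁
  have h₂ := hS w Pd (u.take U)
  -- the value of the body on the genuine pad is the verdict bit
  have hbg : (bgF G.c j (boolPair Pd (fstF w))).length = G.c * 2 ^ (G.c * Nat.sqrt^[j] (fstF w).length) + G.c := by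
    rw [hPd, he, bgF_apply G.c j _ _ (two_pow_gExp_le c G.c sx j hsx w)]
    simp only [ones, List.length_replicate]
  have hval : postF Ref F mv Nb c sx j
      (boolPair (encodeTableOpt (G.gen (Nat.sqrt^[j] (fstF w).length) (sndF w)
        ((sndF (u.take U)).take (bgF G.c j (boolPair Pd (fstF w))).length)))
        (boolPair (boolPair w Pd) (List.takeD (mv.eval (fstF w).length) (fstF (u.take U)) false))) =
      [verdictBit G Ref F mv Nb c sx j w u] := by
    rw [hbg]
    have hg : (sndF (u.take U)).take (G.c * 2 ^ (G.c * Nat.sqrt^[j] (fstF w).length) + G.c) =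
        guessOf G mv j w u := rfl
    have hy : List.takeD (mv.eval (fstF w).length) (fstF (u.take U)) false = msgOf G mv j w u := rfl
    rw [hg, hy, verdictBit]
    cases hgen : G.gen (Nat.sqrt^[j] (fstF w).length) (sndF w) (guessOf G mv j w u) with
    | none => rw [postF_none]
    | some t =>
      rw [postF_some]
      rw [hPd, he]; exact two_pow_seedLen_le_pad c sx j G.c w
  rw [hval] at h₂
  refine (Turing.TM2ComputableAux.comp_outputsWithin _ _ h₁ h₂).mono ?_
  -- time
  have h2e : 2 ^ e ≤ Y := Nat.le_add_right _ _
  have hwY : w.length ≤ Y := Nat.le_add_left _ _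
  have hfst : (fstF w).length ≤ w.length := length_boolUnpair_fst_le w
  have hUle : U ≤ A * Y ^ A + A + G.c * Y + 2 * G.c := by
    have hmv : (2 * mv + 2).eval (fstF w).length ≤ A * Y ^ A + A :=
      (TM2Iter.eval_mono _ (hfst.trans hwY)).trans (hA Y hY1)
    have h1 := two_pow_gExp_le c G.c sx j hsx w
    simp only [ones, List.length_replicate] at h1
    rw [← he] at h1
    have h2 : G.c * 2 ^ (G.c * Nat.sqrt^[j] (fstF w).length) ≤ G.c * (Y + 1) :=
      Nat.mul_le_mul_left _ (h1.trans (by omega))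
    have h3 : G.c * (Y + 1) = G.c * Y + G.c := by ring
    simp only [hU, keptLen]
    omega
  have hTG := genTime_le G c sx j hsx w
  rw [← he, ← hY] at hTG
  have hR : (boolPair (boolPair w Pd) (u.take U)).length ≤ 6 * Y + 8 + U := by
    simp only [length_boolPair, hPd, ones, List.length_replicate]
    have := List.length_take_le U u
    omega
  have hZ : (boolPair (boolPair w Pd) (u.take U)).length +
      (G.c * (2 ^ Nat.sqrt^[j] (fstF w).length + (sndF w).length) ^ G.c + G.c) ≤ B.eval Y := by
    simp only [hB, eval_add, eval_mul, eval_ofNat, eval_X, eval_C, eval_pow]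
    omega
  have hQ : Q.eval ((boolPair (boolPair w Pd) (u.take U)).length +
      (G.c * (2 ^ Nat.sqrt^[j] (fstF w).length + (sndF w).length) ^ G.c + G.c)) ≤ (Q.comp B).eval Y := by
    rw [eval_comp]; exact TM2Iter.eval_mono _ hZ
  have hc := hc₂ Y hY1
  simp only [eval_add, eval_mul, eval_C, eval_X, eval_pow] at hc
  omega

end Verifier

/-! ### The simulation language is in `NTIME(2^{⌈M^ε⌉₊})` -/

section Language

variable {a : ℕ → ℕ} (G : TruthTableGenerator a) (Ref : Language Bool) (F : List Bool → List Bool)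
  (mv Nb : Polynomial ℕ) (c sx j C : ℕ) {ε : ℝ}

/-- **The simulation language**: words `w` having an admissible witness (length `≤ C·2^{⌈|w|^ε⌉₊} + C`)
on which the verifier accepts. [cite: ImpagliazzoKabanetsWigderson2002, Thm. 12 (proof)] -/
def simLang (ε : ℝ) : Language Bool :=
  {w | ∃ u : List Bool, u.length ≤ C * 2 ^ ⌈(w.length : ℝ) ^ ε⌉₊ + C ∧ verdictBit G Ref F mv Nb c sx j w u = true}

variable {G Ref F}

/-- The padding exponent is monotone along `fst w ↦ w`: `e(w) ≤ (c + c_G) m(|w|)²`. [folklore] -/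
theorem expo_le (w : List Bool) : expo c G.c sx j w ≤ (c + G.c) * (Nat.sqrt^[j] w.length) ^ sx :=
  Nat.mul_le_mul_left _ (Nat.pow_le_pow_left (monotone_iterate_sqrt j (length_boolUnpair_fst_le w)) sx)

/-- **The simulation language is in `NTIME(2^{⌈M^ε⌉₊})`** once `2 · 2^{-j} < ε`: the verifier of
`exists_verifier` runs within `c₂ (2^{(c+c_G) m(M)²} + M)^{c₂} + c₂ + |u|/2`, and the first summand is
`≤ c₃ 2^{⌈M^ε⌉₊} + c₃` for all `M` (`eventually_cost_le_two_pow_ceil_rpow`, `exists_const_of_eventually_le`,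
`IKWScales.lean`); with `C = 2c₃ + 2` both clauses of the tree's one-constant `NTIME` hold.
[cite: ImpagliazzoKabanetsWigderson2002, Thm. 12 (proof)] [cite: AroraBarakCC2009, Def. 2.1 / §2.1.2] -/
theorem exists_simLang_mem_NTIME (hsx : 1 ≤ sx) (hRef : Ref ∈ Classes.P) (hF : F ∈ FP)
    (hε : sx * (1 / 2 : ℝ) ^ j < ε) :
    ∃ C : ℕ, 1 ≤ C ∧ simLang G Ref F mv Nb c sx j C ε ∈ NTIME fun M => 2 ^ ⌈(M : ℝ) ^ ε⌉₊ := by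
  obtain ⟨c₂, V, hV⟩ := exists_verifier G mv Nb c sx j hsx hRef hF
  obtain ⟨c₃, hc₃⟩ := exists_const_of_eventually_le (eventually_cost_pow_le_two_pow_ceil_rpow c₂ (c + G.c) sx j hε)
  refine ⟨2 * c₃ + 2, by omega, 2 * c₃ + 2, fun w u => verdictBit G Ref F mv Nb c sx j w u, V,
    fun w u hu => ?_, fun w => Iff.rfl⟩
  have h := hV w u
  have e : encodeBool (verdictBit G Ref F mv Nb c sx j w u) = [verdictBit G Ref F mv Nb c sx j w u] := by
    cases verdictBit G Ref F mv Nb c sx j w u <;> rfl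
  rw [e]
  beta_reduce at hu ⊢
  refine h.mono ?_
  have h1 : c₂ * (2 ^ expo c G.c sx j w + w.length) ^ c₂ + c₂ ≤
      c₂ * (2 ^ ((c + G.c) * (Nat.sqrt^[j] w.length) ^ sx) + w.length) ^ c₂ + c₂ :=
    Nat.add_le_add_right (Nat.mul_le_mul_left _ (Nat.pow_le_pow_left
      (Nat.add_le_add_right (Nat.pow_le_pow_right (by norm_num) (expo_le c sx j w)) _) _)) _
  have h2 : c₂ * (2 ^ ((c + G.c) * (Nat.sqrt^[j] w.length) ^ sx) + w.length) ^ c₂ + c₂ ≤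
      c₃ * 2 ^ ⌈(w.length : ℝ) ^ ε⌉₊ + c₃ := hc₃ w.length
  generalize hT : 2 ^ ⌈(w.length : ℝ) ^ ε⌉₊ = T at hu h2 ⊢
  have e1 : (2 * c₃ + 2) * T = 2 * (c₃ * T) + 2 * T := by ring
  rw [e1] at hu ⊢
  omega

end Language

end IKWSim

end Literature.Computability.Complexity

end
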